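import Mathlib
import Literature.MathematicalPhysics.StatisticalMechanics.LocalMatchingCompactness
import Literature.MathematicalPhysics.StatisticalMechanics.CrystallizationLocalLimit
import Literature.NumberTheory.UniformDistribution.Invariances
import Summits.AtomisticToContinuum.Crystallization.Theorems.BraggSlacknessRigidityHcpDiffractionRigidityLocalLimitTransferAux

/-!
# Local limit with inherited exactness and quietness (stub `stub_localLimitTransfer` of crux
# `HcpDiffractionRigidity`, item `stmt-AtomisticToContinuum-13166`, line `registered`)

**Stub B1 of Half B.** A hard-core (`δ`-separated) sequence of finite configurations `y j` of
`ℝ³`, each centred at a particle, with asymptotically exact windows (pair distances in every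
window eventually `η`-close to template distances of a periodic configuration `P`) and
Gaussian-quiet windows along scales `L t → ∞`, has a subsequence converging locally (two-way
`ε`-matching on every ball about `0`) to a `δ`-separated set `Λ ∋ 0` all of whose pair distances
are template distances and whose Gaussian windows are quiet along the SAME scales (tsum form).

* extraction: `exists_subseq_forall_eventually_ballMatch` (sequential compactness of separated
  point sets in the local matching topology) applied to the ranges of the `y j`;
* `0 ∈ Λ` (`HcpRigidityLocalLimit.zero_mem_of_near`): every configuration has a particle at `0`;
* exact distances (`HcpRigidityLocalLimit.exists_dist_eq`): the template distances below any bound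
  form a finite set (`HcpRigidityLocalLimit.finite_dist_le`: a periodic configuration is locally
  finite), and `dist p q` is within every `η > 0` of it;
* quietness (`HcpRigidityLocalLimit.tendsto_gaussMass`, `tendsto_windowedIntensity`): at a fixed
  scale `L > 0` the Gaussian mass `∑ᵢ e^{-2|yᵢ|²/L²}` and the windowed intensity
  `∫ h |∑ᵢ e^{-|yᵢ|²/L²} e^{2πi⟨ξ,yᵢ⟩}|²` converge along the subsequence to their `Λ`-versions
  (local convergence of Gaussian-dominated sums,
  `HcpRigidityLocalLimit.tendsto_sum_of_near_of_gauss` of the Aux file, plus dominated convergence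
  in `ξ` with the uniform bound `HcpRigidityLocalLimit.sum_gauss_le`), so the eventual inequality
  passes to the limit.

All `[folklore]`.
-/

noncomputable section

namespace Summit.AtomisticToContinuum.Crystallization.Theorems

namespace HcpRigidityLocalLimit

open Filter Metric Set MeasureTheory
open scoped BigOperators Topology
open Literature.MathematicalPhysics.StatisticalMechanics

/-! ## Template distances below a bound form a finite set -/

/-- The distances `dist a b ≤ M` between points of a periodic configuration form a finite set
(translate `a` into the motif; the configuration is locally finite). [folklore] -/
theorem finite_dist_le (P : PeriodicConfiguration 3) (M : ℝ) :
    {r : ℝ | ∃ a ∈ P.points, ∃ b ∈ P.points, r = dist a b ∧ r ≤ M}.Finite := by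
  have hfin : ∀ x : EuclideanSpace ℝ (Fin 3), (closedBall x M ∩ P.points).Finite := fun x =>
    P.finite_inter_points isBounded_closedBall
  refine ((P.motif.finite_toSet.biUnion fun x _ => (hfin x).image (dist x))).subset ?_
  rintro r ⟨a, ⟨x, hx, g, hg, rfl⟩, b, hb, rfl, hrM⟩
  have hd : dist x (b - g) = dist (x + g) b := by
    rw [dist_eq_norm, dist_eq_norm]
    congr 1
    abel
  refine Set.mem_biUnion hx ⟨b - g, ⟨?_, ?_⟩, hd⟩
  · rw [mem_closedBall, dist_comm, hd]
    exact hrM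
  · simpa [sub_eq_add_neg] using P.add_mem_points hb (P.lattice.neg_mem hg)

/-- **Exact distances pass to the local limit.** If finite configurations `z k` with
asymptotically exact windows (pair distances in every window eventually `η`-close to template
distances, for every `η > 0`) converge locally to a `δ`-separated set `Λ`, then every pair distance
of `Λ` IS a template distance (the template distances below a bound form a finite, hence closed,
set). [folklore] -/
theorem exists_dist_eq (P : PeriodicConfiguration 3) {m : ℕ → ℕ}
    (z : (k : ℕ) → Fin (m k) → EuclideanSpace ℝ (Fin 3)) (Λ : Set (EuclideanSpace ℝ (Fin 3)))
    {δ : ℝ} (hδ : 0 < δ) (hΛ : ∀ p ∈ Λ, ∀ q ∈ Λ, p ≠ q → δ ≤ dist p q)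
    (hexact : ∀ R η : ℝ, 0 < η → ∀ᶠ k in atTop, ∀ i i' : Fin (m k), i ≠ i' → ‖z k i‖ ≤ R →
      ‖z k i'‖ ≤ R → ∃ a ∈ P.points, ∃ b ∈ P.points, |dist (z k i) (z k i') - dist a b| < η)
    (h : ∀ R ε : ℝ, 0 < ε → ∀ᶠ k in atTop,
        (∀ p ∈ Λ, ‖p‖ ≤ R → ∃ i, dist (z k i) p ≤ ε) ∧
        (∀ i, ‖z k i‖ ≤ R → ∃ p ∈ Λ, dist (z k i) p ≤ ε))
    {p q : EuclideanSpace ℝ (Fin 3)} (hp : p ∈ Λ) (hq : q ∈ Λ) :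
    ∃ a ∈ P.points, ∃ b ∈ P.points, dist p q = dist a b := by
  by_cases hpq : p = q
  · obtain ⟨a, ha⟩ := P.points_nonempty
    exact ⟨a, ha, a, ha, by rw [hpq, dist_self, dist_self]⟩
  have hdpq : δ ≤ dist p q := hΛ p hp q hq hpq
  set M := dist p q + 1 with hM
  set D : Set ℝ := {r : ℝ | ∃ a ∈ P.points, ∃ b ∈ P.points, r = dist a b ∧ r ≤ M} with hD
  have hDfin : D.Finite := finite_dist_le P M
  suffices hcl : dist p q ∈ closure D by
    rw [hDfin.isClosed.closure_eq] at hcl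
    obtain ⟨a, ha, b, hb, hr, -⟩ := hcl
    exact ⟨a, ha, b, hb, hr⟩
  rw [Metric.mem_closure_iff]
  intro η hη
  set η₀ := min η 1 / 4 with hη₀
  have hη₀0 : 0 < η₀ := by positivity
  have hη₀η : 3 * η₀ < η := by
    have : min η 1 ≤ η := min_le_left _ _
    rw [hη₀]; linarith
  have hη₀1 : η₀ ≤ 1 / 4 := by
    have : min η 1 ≤ 1 := min_le_right _ _
    rw [hη₀]; linarith
  set ε := min η₀ (δ / 4) with hε
  have hε0 : 0 < ε := by positivity
  have hεη : ε ≤ η₀ := min_le_left _ _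
  have hεδ : ε ≤ δ / 4 := min_le_right _ _
  set R := max ‖p‖ ‖q‖ + 1 with hR
  obtain ⟨k, hEk, hCk, -⟩ := ((hexact R η₀ hη₀0).and (h R ε hε0)).exists
  obtain ⟨i, hi⟩ := hCk p hp (by rw [hR]; linarith [le_max_left ‖p‖ ‖q‖])
  obtain ⟨i', hi'⟩ := hCk q hq (by rw [hR]; linarith [le_max_right ‖p‖ ‖q‖])
  have hii' : i ≠ i' := by
    intro hii'
    rw [hii'] at hi
    have : dist p q ≤ dist (z k i') p + dist (z k i') q := dist_triangle_left _ _ _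
    linarith
  have hnear : ∀ (j : Fin (m k)) (u : EuclideanSpace ℝ (Fin 3)), dist (z k j) u ≤ ε →
      ‖u‖ ≤ max ‖p‖ ‖q‖ → ‖z k j‖ ≤ R := by
    intro j u hju hu
    have h1 : ‖z k j‖ ≤ ‖u‖ + ‖z k j - u‖ := norm_le_norm_add_norm_sub' _ _
    rw [← dist_eq_norm] at h1
    rw [hR]; linarith
  obtain ⟨a, ha, b, hb, hab⟩ := hEk i i' hii' (hnear i p hi (le_max_left _ _))
    (hnear i' q hi' (le_max_right _ _))
  have hd : |dist p q - dist (z k i) (z k i')| ≤ 2 * ε := by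
    rw [abs_sub_le_iff]
    constructor
    · linarith [dist_triangle4 p (z k i) (z k i') q, dist_comm p (z k i)]
    · linarith [dist_triangle4 (z k i) p q (z k i'), dist_comm q (z k i')]
  have hab' := abs_sub_lt_iff.1 hab
  refine ⟨dist a b, ⟨a, ha, b, hb, rfl, ?_⟩, ?_⟩
  · have := (abs_sub_le_iff.1 hd).2
    rw [hM]; linarith
  · rw [Real.dist_eq]
    calc |dist p q - dist a b|
        ≤ |dist p q - dist (z k i) (z k i')| + |dist (z k i) (z k i') - dist a b| :=
          abs_sub_le _ _ _
      _ < 2 * ε + η₀ := add_lt_add_of_le_of_lt hd hab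
      _ ≤ 3 * η₀ := by linarith
      _ < η := hη₀η

/-! ## The origin belongs to the local limit -/

/-- If finite configurations each containing the origin converge locally to a `δ`-separated set
`Λ`, then `0 ∈ Λ` (points of `Λ` arbitrarily close to `0` exist, and separation forces them to
coincide). [folklore] -/
theorem zero_mem_of_near {m : ℕ → ℕ} (z : (k : ℕ) → Fin (m k) → EuclideanSpace ℝ (Fin 3))
    (Λ : Set (EuclideanSpace ℝ (Fin 3))) {δ : ℝ} (hδ : 0 < δ)
    (hΛ : ∀ p ∈ Λ, ∀ q ∈ Λ, p ≠ q → δ ≤ dist p q) (h0 : ∀ k, ∃ i, z k i = 0)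
    (h : ∀ R ε : ℝ, 0 < ε → ∀ᶠ k in atTop,
        (∀ p ∈ Λ, ‖p‖ ≤ R → ∃ i, dist (z k i) p ≤ ε) ∧
        (∀ i, ‖z k i‖ ≤ R → ∃ p ∈ Λ, dist (z k i) p ≤ ε)) :
    (0 : EuclideanSpace ℝ (Fin 3)) ∈ Λ := by
  have hnear : ∀ ε : ℝ, 0 < ε → ∃ p ∈ Λ, ‖p‖ ≤ ε := by
    intro ε hε
    obtain ⟨k, -, hk⟩ := (h 0 ε hε).exists
    obtain ⟨i₀, hi₀⟩ := h0 k
    obtain ⟨p, hp, hd⟩ := hk i₀ (by rw [hi₀, norm_zero])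
    refine ⟨p, hp, ?_⟩
    rwa [hi₀, dist_comm, dist_zero_right] at hd
  obtain ⟨p₀, hp₀, hp₀n⟩ := hnear (δ / 4) (by positivity)
  suffices hp : p₀ = 0 by rwa [hp] at hp₀
  by_contra hne
  have hpos : 0 < ‖p₀‖ := norm_pos_iff.2 hne
  obtain ⟨p₁, hp₁, hp₁n⟩ := hnear (min (‖p₀‖ / 2) (δ / 4)) (by positivity)
  have h1 := (le_min_iff.1 hp₁n).1
  have h2 := (le_min_iff.1 hp₁n).2
  have hne' : p₀ ≠ p₁ := by
    intro h
    rw [← h] at h1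
    linarith
  have h3 := hΛ p₀ hp₀ p₁ hp₁ hne'
  have : dist p₀ p₁ ≤ ‖p₀‖ + ‖p₁‖ := dist_le_norm_add_norm _ _
  linarith

/-! ## Gaussian mass and windowed intensity at a fixed scale -/

/-- The Gaussian-weighted structure factor of a `δ`-separated configuration is bounded uniformly:
`|∑ᵢ e^{-|yᵢ|²/L²} e^{2πi⟨ξ,yᵢ⟩}| ≤ 2(2/δ+1)³(4πL²+1)³`. [folklore] -/
theorem norm_gaussSum_le {N : ℕ} (y : Fin N → EuclideanSpace ℝ (Fin 3)) {δ : ℝ} (hδ : 0 < δ)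
    (hsep : ∀ i j, i ≠ j → δ ≤ dist (y i) (y j)) {L : ℝ} (hL : 0 < L)
    (ξ : EuclideanSpace ℝ (Fin 3)) :
    ‖∑ i, (Real.exp (-(‖y i‖ ^ 2) / L ^ 2) : ℂ) *
        Complex.exp (2 * Real.pi * Complex.I * (inner ℝ ξ (y i) : ℂ))‖ ≤
      2 * (2 / δ + 1) ^ 3 * (4 * Real.pi * L ^ 2 + 1) ^ 3 := by
  refine (norm_sum_le _ _).trans (le_trans (le_of_eq (Finset.sum_congr rfl fun i _ => ?_))
    (sum_gauss_le y hδ hsep hL))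
  rw [norm_mul, Literature.NumberTheory.UniformDistribution.norm_cexp_two_pi_mul_ofReal, mul_one,
    Complex.norm_real, Real.norm_eq_abs, abs_of_nonneg (Real.exp_pos _).le]

variable {m : ℕ → ℕ} (z : (k : ℕ) → Fin (m k) → EuclideanSpace ℝ (Fin 3))
  (Λ : Set (EuclideanSpace ℝ (Fin 3))) {δ : ℝ}

/-- **The Gaussian mass passes to the local limit**: at a fixed scale `L > 0`,
`∑ᵢ (e^{-|z k i|²/L²})² → ∑' s : Λ, (e^{-|s|²/L²})²`. [folklore] -/
theorem tendsto_gaussMass (hδ : 0 < δ) (hsep : ∀ k i i', i ≠ i' → δ ≤ dist (z k i) (z k i'))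
    (hΛ : ∀ p ∈ Λ, ∀ q ∈ Λ, p ≠ q → δ ≤ dist p q)
    (h : ∀ R ε : ℝ, 0 < ε → ∀ᶠ k in atTop,
        (∀ p ∈ Λ, ‖p‖ ≤ R → ∃ i, dist (z k i) p ≤ ε) ∧
        (∀ i, ‖z k i‖ ≤ R → ∃ p ∈ Λ, dist (z k i) p ≤ ε))
    {L : ℝ} (hL : 0 < L) :
    Tendsto (fun k => ∑ i, Real.exp (-(‖z k i‖ ^ 2) / L ^ 2) ^ 2) atTop
      (𝓝 (∑' s : Λ, Real.exp (-(‖(s : EuclideanSpace ℝ (Fin 3))‖ ^ 2) / L ^ 2) ^ 2)) := by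
  refine tendsto_sum_of_near_of_gauss z Λ hδ hsep hΛ h hL (C := 1)
    (f := fun x => Real.exp (-(‖x‖ ^ 2) / L ^ 2) ^ 2) (by fun_prop) fun x => ?_
  rw [Real.norm_eq_abs, abs_of_nonneg (sq_nonneg _), one_mul, sq]
  refine mul_le_of_le_one_left (Real.exp_pos _).le ?_
  rw [Real.exp_le_one_iff]
  exact div_nonpos_of_nonpos_of_nonneg (neg_nonpos.2 (sq_nonneg _)) (sq_nonneg _)

/-- **The Gaussian-weighted structure factor passes to the local limit**, pointwise in `ξ`:
`∑ᵢ e^{-|z k i|²/L²} e^{2πi⟨ξ, z k i⟩} → ∑' s : Λ, e^{-|s|²/L²} e^{2πi⟨ξ,s⟩}`. [folklore] -/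
theorem tendsto_gaussSum (hδ : 0 < δ) (hsep : ∀ k i i', i ≠ i' → δ ≤ dist (z k i) (z k i'))
    (hΛ : ∀ p ∈ Λ, ∀ q ∈ Λ, p ≠ q → δ ≤ dist p q)
    (h : ∀ R ε : ℝ, 0 < ε → ∀ᶠ k in atTop,
        (∀ p ∈ Λ, ‖p‖ ≤ R → ∃ i, dist (z k i) p ≤ ε) ∧
        (∀ i, ‖z k i‖ ≤ R → ∃ p ∈ Λ, dist (z k i) p ≤ ε))
    {L : ℝ} (hL : 0 < L) (ξ : EuclideanSpace ℝ (Fin 3)) :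
    Tendsto (fun k => ∑ i, (Real.exp (-(‖z k i‖ ^ 2) / L ^ 2) : ℂ) *
        Complex.exp (2 * Real.pi * Complex.I * (inner ℝ ξ (z k i) : ℂ))) atTop
      (𝓝 (∑' s : Λ, (Real.exp (-(‖(s : EuclideanSpace ℝ (Fin 3))‖ ^ 2) / L ^ 2) : ℂ) *
        Complex.exp (2 * Real.pi * Complex.I *
          (inner ℝ ξ (s : EuclideanSpace ℝ (Fin 3)) : ℂ)))) := by
  refine tendsto_sum_of_near_of_gauss z Λ hδ hsep hΛ h hL (C := 1)
    (f := fun x => (Real.exp (-(‖x‖ ^ 2) / L ^ 2) : ℂ) *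
      Complex.exp (2 * Real.pi * Complex.I * (inner ℝ ξ x : ℂ))) (by fun_prop) fun x => ?_
  rw [norm_mul, Literature.NumberTheory.UniformDistribution.norm_cexp_two_pi_mul_ofReal, mul_one,
    Complex.norm_real, Real.norm_eq_abs, abs_of_nonneg (Real.exp_pos _).le, one_mul]

/-- **The Gaussian-windowed intensity passes to the local limit**: for `h` continuous with compact
support and a fixed scale `L > 0`,
`∫ h |∑ᵢ e^{-|z k i|²/L²} e^{2πi⟨ξ,z k i⟩}|² dξ → ∫ h |∑' s : Λ, e^{-|s|²/L²} e^{2πi⟨ξ,s⟩}|² dξ`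
(dominated convergence: pointwise convergence in `ξ` and the uniform bound `norm_gaussSum_le`).
[folklore] -/
theorem tendsto_windowedIntensity (hδ : 0 < δ)
    (hsep : ∀ k i i', i ≠ i' → δ ≤ dist (z k i) (z k i'))
    (hΛ : ∀ p ∈ Λ, ∀ q ∈ Λ, p ≠ q → δ ≤ dist p q)
    (h : ∀ R ε : ℝ, 0 < ε → ∀ᶠ k in atTop,
        (∀ p ∈ Λ, ‖p‖ ≤ R → ∃ i, dist (z k i) p ≤ ε) ∧
        (∀ i, ‖z k i‖ ≤ R → ∃ p ∈ Λ, dist (z k i) p ≤ ε))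
    {L : ℝ} (hL : 0 < L) {f : EuclideanSpace ℝ (Fin 3) → ℝ} (hfc : Continuous f)
    (hf : HasCompactSupport f) :
    Tendsto (fun k => ∫ ξ, f ξ * ‖∑ i, (Real.exp (-(‖z k i‖ ^ 2) / L ^ 2) : ℂ) *
        Complex.exp (2 * Real.pi * Complex.I * (inner ℝ ξ (z k i) : ℂ))‖ ^ 2) atTop
      (𝓝 (∫ ξ, f ξ * ‖∑' s : Λ, (Real.exp (-(‖(s : EuclideanSpace ℝ (Fin 3))‖ ^ 2) / L ^ 2) : ℂ) *
        Complex.exp (2 * Real.pi * Complex.I *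
          (inner ℝ ξ (s : EuclideanSpace ℝ (Fin 3)) : ℂ))‖ ^ 2)) := by
  set B : ℝ := 2 * (2 / δ + 1) ^ 3 * (4 * Real.pi * L ^ 2 + 1) ^ 3 with hB
  refine tendsto_integral_of_dominated_convergence (fun ξ => ‖f ξ‖ * B ^ 2) (fun k => ?_)
    (((hfc.integrable_of_hasCompactSupport hf).norm.mul_const (B ^ 2)))
    (fun k => ae_of_all _ fun ξ => ?_)
    (ae_of_all _ fun ξ => ?_)
  · exact (Continuous.mul hfc (by fun_prop)).aestronglyMeasurable
  · rw [norm_mul, Real.norm_of_nonneg (by positivity : (0 : ℝ) ≤ ‖_‖ ^ 2)]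
    gcongr
    exact norm_gaussSum_le (z k) hδ (hsep k) hL ξ
  · exact ((tendsto_gaussSum z Λ hδ hsep hΛ h hL ξ).norm.pow 2).const_mul (f ξ)

end HcpRigidityLocalLimit

open Filter
open scoped BigOperators Classical
open Literature.MathematicalPhysics.StatisticalMechanics

/-- **Stub B1 of `HcpDiffractionRigidity` — local limit with inherited exactness and quietness.**
For any periodic template `P` and a hard-core sequence of finite configurations `y j` of `ℝ³`
centred at a particle, with asymptotically exact windows and Gaussian-quiet windows along scales
`L t → ∞`, some subsequence converges locally (two-way `ε`-matching on every ball about `0`) to a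
`δ`-separated set `Λ ∋ 0` all of whose pair distances are template distances and whose Gaussian
windows are quiet along the same scales (tsum form). [folklore] -/
theorem stub_localLimitTransfer : ∀ (P : Literature.MathematicalPhysics.StatisticalMechanics.PeriodicConfiguration 3) (δ : ℝ), 0 < δ → ∀ (n : ℕ → ℕ) (y : (j : ℕ) → (Fin (n j) → EuclideanSpace ℝ (Fin 3))), (∀ (j : ℕ) (i i' : Fin (n j)), i ≠ i' → δ ≤ dist (y j i) (y j i')) → (∀ j : ℕ, ∃ i : Fin (n j), y j i = 0) → (∀ R η : ℝ, 0 < η → ∀ᶠ j : ℕ in Filter.atTop, ∀ i i' : Fin (n j), i ≠ i' → ‖y j i‖ ≤ R → ‖y j i'‖ ≤ R → ∃ a ∈ P.points, ∃ b ∈ P.points, |dist (y j i) (y j i') - dist a b| < η) → (∃ L : ℕ → ℝ, Filter.Tendsto L Filter.atTop Filter.atTop ∧ ∀ h : EuclideanSpace ℝ (Fin 3) → ℝ, Continuous h → HasCompactSupport h → (∀ ξ ∈ tsupport h, ξ ≠ 0 ∧ ∀ k : EuclideanSpace ℝ (Fin 3), (∀ g ∈ P.lattice, ∃ n : ℤ,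 inner ℝ k g = (n : ℝ)) → ‖ξ‖ ≠ ‖k‖) → ∀ ε : ℝ, 0 < ε → ∀ᶠ t : ℕ in Filter.atTop, ∀ᶠ j : ℕ in Filter.atTop, (∫ ξ, h ξ * ‖∑ i : Fin (n j), (Real.exp (-(‖y j i‖ ^ 2) / L t ^ 2) : ℂ) * Complex.exp (2 * Real.pi * Complex.I * (inner ℝ ξ (y j i) : ℂ))‖ ^ 2) ≤ ε * ∑ i : Fin (n j), Real.exp (-(‖y j i‖ ^ 2) / L t ^ 2) ^ 2) → ∃ (ψ : ℕ → ℕ) (Λ : Set (EuclideanSpace ℝ (Fin 3))), StrictMono ψ ∧ (∀ p ∈ Λ, ∀ q ∈ Λ, p ≠ q → δ ≤ dist p q) ∧ (0 : EuclideanSpace ℝ (Fin 3)) ∈ Λ ∧ (∀ p ∈ Λ, ∀ q ∈ Λ, ∃ a ∈ P.points, ∃ b ∈ P.points, dist p q = dist a b) ∧ (∃ L : ℕ → ℝ, Filter.Tendsto L Filter.atTop Filter.atTop ∧ ∀ h : EuclideanSpace ℝ (Fin 3) → ℝ, Continuous h → HasCompactSupport h → (∀ ξ ∈ tsupport h, ξ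 ≠ 0 ∧ ∀ k : EuclideanSpace ℝ (Fin 3), (∀ g ∈ P.lattice, ∃ n : ℤ, inner ℝ k g = (n : ℝ)) → ‖ξ‖ ≠ ‖k‖) → ∀ ε : ℝ, 0 < ε → ∀ᶠ t : ℕ in Filter.atTop, (∫ ξ, h ξ * ‖∑' s : Λ, (Real.exp (-(‖(s : EuclideanSpace ℝ (Fin 3))‖ ^ 2) / L t ^ 2) : ℂ) * Complex.exp (2 * Real.pi * Complex.I * (inner ℝ ξ (s : EuclideanSpace ℝ (Fin 3)) : ℂ))‖ ^ 2) ≤ ε * ∑' s : Λ, Real.exp (-(‖(s : EuclideanSpace ℝ (Fin 3))‖ ^ 2) / L t ^ 2) ^ 2) ∧ (∀ R ε : ℝ, 0 < ε → ∀ᶠ k : ℕ in Filter.atTop, (∀ p ∈ Λ, ‖p‖ ≤ R → ∃ i : Fin (n (ψ k)), dist (y (ψ k) i) p ≤ ε) ∧ (∀ i : Fin (n (ψ k)), ‖y (ψ k) i‖ ≤ R → ∃ p ∈ Λ, dist (y (ψ k) i) p ≤ ε)) := by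
  intro P δ hδ n y hsep hcen hexact hquiet
  -- (1) extraction of a locally convergent subsequence
  have hYsep : ∀ j, ∀ p ∈ Set.range (y j), ∀ q ∈ Set.range (y j), p ≠ q → δ ≤ dist p q := by
    rintro j p ⟨i, rfl⟩ q ⟨i', rfl⟩ hpq
    exact hsep j i i' fun h => hpq (by rw [h])
  obtain ⟨ψ, Λ, hψ, hΛsep, hmatch⟩ :=
    exists_subseq_forall_eventually_ballMatch hδ (fun j => Set.range (y j)) hYsep
  have hconv : ∀ R ε : ℝ, 0 < ε → ∀ᶠ k : ℕ in Filter.atTop,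
      (∀ p ∈ Λ, ‖p‖ ≤ R → ∃ i : Fin (n (ψ k)), dist (y (ψ k) i) p ≤ ε) ∧
      (∀ i : Fin (n (ψ k)), ‖y (ψ k) i‖ ≤ R → ∃ p ∈ Λ, dist (y (ψ k) i) p ≤ ε) := by
    intro R ε hε
    filter_upwards [hmatch R ε hε] with k hk
    obtain ⟨hk1, hk2⟩ := hk
    refine ⟨fun p hp hpR => ?_, fun i hiR => ?_⟩
    · obtain ⟨a, ⟨i, rfl⟩, hai⟩ := hk1 p hp (by rwa [dist_zero_right])
      exact ⟨i, hai⟩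
    · exact hk2 (y (ψ k) i) ⟨i, rfl⟩ (by rwa [dist_zero_right])
  have hsepψ : ∀ (k : ℕ) (i i' : Fin (n (ψ k))), i ≠ i' → δ ≤ dist (y (ψ k) i) (y (ψ k) i') :=
    fun k => hsep (ψ k)
  -- (2) the origin, (3) exact distances
  have h0 : (0 : EuclideanSpace ℝ (Fin 3)) ∈ Λ :=
    HcpRigidityLocalLimit.zero_mem_of_near (fun k => y (ψ k)) Λ hδ hΛsep (fun k => hcen (ψ k)) hconv
  have hdist : ∀ p ∈ Λ, ∀ q ∈ Λ, ∃ a ∈ P.points, ∃ b ∈ P.points, dist p q = dist a b :=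
    fun p hp q hq => HcpRigidityLocalLimit.exists_dist_eq P (fun k => y (ψ k)) Λ hδ hΛsep
      (fun R η hη => hψ.tendsto_atTop.eventually (hexact R η hη)) hconv hp hq
  -- (4) quietness along the same scales
  obtain ⟨L, hL, hq⟩ := hquiet
  refine ⟨ψ, Λ, hψ, hΛsep, h0, hdist, ⟨L, hL, fun h hc hcs hadm ε hε => ?_⟩, hconv⟩
  filter_upwards [hq h hc hcs hadm ε hε, hL.eventually_gt_atTop 0] with t hqt hLt
  exact le_of_tendsto_of_tendsto
    (HcpRigidityLocalLimit.tendsto_windowedIntensity (fun k => y (ψ k)) Λ hδ hsepψ hΛsep hconv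
      hLt hc hcs)
    ((HcpRigidityLocalLimit.tendsto_gaussMass (fun k => y (ψ k)) Λ hδ hsepψ hΛsep hconv
      hLt).const_mul ε)
    (hψ.tendsto_atTop.eventually hqt)

end Summit.AtomisticToContinuum.Crystallization.Theorems

end
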